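/-
Origin: expansion seat `prover-pub-hodgecm-own-htheta-g2-0`, handover #H26 2026-08-21T13:47:42Z md5 6ed7072ebc8a (140 l.; NEW additive MODEL leaf — `_ge` twin(s) D16 D17: hyp34_of_census_R1At_of_hμ₃₄_ge, hyp34_of_census_R1At_GOG_ge; imports HypCensus.KappaJoinMu34 + #H24; author item6-p2 (prover-pub-hodgecm2-item6-p2-0) under own-htheta; nothing cited, NOT an E term; sha256 d5a16d2d5449fb733195f8550a6513825c752b339dbad83993cd45735659b2cf; CERT rc 0 + trio as in the header; NAMES for audit: HodgeCM.Model.HypCensus.hyp34_of_census_R1At_of_hμ₃₄_ge HodgeCM.Model.HypCensus.hyp34_of_census_R1At_GOG_ge ) (`HOME/pub-hodgecm-own-htheta/stage80/HodgeCM/Model/HypCensus/KappaJoinMu34Ge.lean`, md5 6ed7072ebc8a, 140 lines);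
landed by the p-seat packager p gen 32 (p-g32) in gate run 79 as `HodgeCM/Model/HypCensus/KappaJoinMu34Ge.lean` (verbatim).
-/
/-
Copyright (c) 2026 the pub-hodgecm formalisation cell (harness21).  New file, not vendored.
Origin: seat `prover-pub-hodgecm2-item6-p2-0` (unit pub-hodgecm2-item6-p2, TRANSPOSITION item (vi) extra prover p2 queued behind the own-htheta
lineage; coordinator ruling 2026-08-21T13:01:49Z), 2026-08-21 — assignment own-htheta g2 pub-hodgecm STATUS l.15865 13:09:09Z «item6-p2 = batch 2
of the (vi-2) D-HEAD `_ge` TWINS» (hodge-director/ITEM6-SPLIT.md (vi-2)/(vi-4); x2 `D-HEADS-THREADING.md` 8761fc1d3358; x2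
`E-HEADS-FACE-BLUEPRINT.md` 456cabd0ac10 §1 rows `hyp12`/`hyp34`).  Target in PKG: `HodgeCM/Model/HypCensus/KappaJoinMu34Ge.lean` (NEW additive leaf beside
`HodgeCM/Model/HypCensus/KappaJoinMu34.lean`, installed md5 8cfa45e7786d; imports `KappaJoinMu34.lean` + `KappaJoinGe`; nothing of record imports it).  KERNEL ONLY: theorems,
no proof holes, nothing cited, no hypothesis kind of E, no `def`; nothing here is a claim of the manuscripts under adjudication; HC_CM is NOT proved.

WHAT IT IS — the `_ge` twins of D16 `hyp34_of_census_R1At_of_hμ₃₄` (:76) and D17 `hyp34_of_census_R1At_GOG` (:132):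
statements VERBATIM with the sextic guard `(hK : Module.finrank ℚ c.K = 6)` replaced by `(hK : 6 ≤ Module.finrank ℚ c.K)` (what a rank-four face of a
Galois CM field `F` of degree ≥ 6 supplies at `c.K := F`), proofs = the originals' with the ONE call `hyp34_of_census_R1At` (resp. `hyp34_of_census_R1At_of_hμ₃₄`) replaced by its `_ge` twin (`KappaJoinGe.lean` / this file).
E's sextic heads are the instances `hK := h6.ge` (`Model.six_le_of_finrank_eq_six`, `ThetaSpaceInputPinGe.lean`:76).  The `Fin 6` in
`jD : InfinitePlace L → EqVar → Fin 6` / `FinSB L⁺ (Fin 6)` is `EqVar := Fin 3 × Fin 2` = the 3 × 2 real coordinates of `V₃ ⊗ W` (rank-keyed), not a degree.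
Generated from the installed original by `work/gen_twins.py` (token edits listed in `work/gen_twins.report`); section variables byte-identical.
-/
import Summits.HodgeConjecture.HodgeCM.Model.HypCensus.KappaJoinMu34
import Summits.HodgeConjecture.HodgeCM.Model.HypCensus.KappaJoinGe

/-! PORT of `HodgeCM/Model/HypCensus/KappaJoinMu34Ge.lean` (HodgeCMPerL run 82) — verbatim mechanical port; provenance in the PORT header line. -/

set_option autoImplicit false

noncomputable section

open scoped TensorProduct InnerProductSpace Matrix Topology Classical
open Filter
open NumberField NumberField.InfinitePlace

namespace HodgeCM.Model.HypCensus

open HodgeCM HodgeCM.Model HodgeCM.Universe HodgeCM.Adelic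
open HodgeCM.Universe (AdelicThetaCore AdelicThetaCore₀ SideData ThetaModel)
open HodgeCM.PerL34 HodgeCM.PerL34.ArchC HodgeCM.PerL34.Fock HodgeCM.PerL34.Fock.PrintDict
open HodgeCM.Model.ArchSideTerm (e₁ posIdxEquivUnit negIdxEquivEmpty lambdaExponent dW' dW'_real dW'_ne)
open Literature.AlgebraicGeometry.HodgeTheory
open Literature.NumberTheory.Automorphic.PicardCM
open Literature.NumberTheory.Transcendental (Arapura2012_Cor_15_4_6)
open Literature.NumberTheory.Automorphic (piSchwartzBruhat FinSB)
open Literature.NumberTheory.Automorphic.UnitaryGroup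
open Literature.NumberTheory.Weil1964 (repWeilThetaDatum PosIdx NegIdx)
open Literature.NumberTheory.GelbartRogawski1991 Literature.NumberTheory.GelbartRogawski1991.UnitaryDualPair
open Literature.RepresentationTheory.CompactGroups (UnitaryGroupChar.diagU UnitaryGroupChar.coe_diagU)
open NumberField.SeesawArchTorus



section R1

variable (hHD : exists_isReal_hodgeModel) (hI : hodgePQ_independent_of_hodgeModel)
  (h₁ : BallQuotientUniformised)  (h₃ : CMAbelianVarietyRealised)
variable (hA : Arapura2012_Cor_15_4_6)
variable
  (hGR : ∀ {L : CMField} {ι₁ : L →+* ℂ} (V : HermSpace3 L ι₁) (c : SeesawCtx L),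
    (cmSplittingDatum (L : Type) finProdFinEquiv (frameD V) (frameD_real V) (frameD_ne V) (dW c.D) (dW_real c.D) (dW_ne c.D)).CompatibleSplitting)
  (hGR₀ : ∀ {L : CMField} {ι₁ : L →+* ℂ} (V : HermSpace3 L ι₁) (c : SeesawCtx L),
    (cmSplittingDatum (L : Type) (e₁) (frameD V) (frameD_real V) (frameD_ne V) (lineVec (L : Type) (dW c.D 0))
      (fun _ => dW_real c.D 0) (fun _ => dW_ne c.D 0)).CompatibleSplitting)
  (hGR₁ : ∀ {L : CMField} {ι₁ : L →+* ℂ} (V : HermSpace3 L ι₁) (c : SeesawCtx L),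
    (cmSplittingDatum (L : Type) (e₁) (frameD V) (frameD_real V) (frameD_ne V) (lineVec (L : Type) (dW c.D 1))
      (fun _ => dW_real c.D 1) (fun _ => dW_ne c.D 1)).CompatibleSplitting)
  (χW : ∀ {L : CMField} {ι₁ : L →+* ℂ} (_V : HermSpace3 L ι₁) (_c : SeesawCtx L),
    ContinuousMonoidHom (Literature.NumberTheory.Automorphic.relNormOneIdeles (maximalRealSubfield (L : Type)) (L : Type) ⧸
      Literature.NumberTheory.Automorphic.relNormOneRat (maximalRealSubfield (L : Type)) (L : Type)) Circle)
  (S : ∀ {L : CMField} {ι₁ : L →+* ℂ} (V : HermSpace3 L ι₁) (c : SeesawCtx L), ThetaAdelicSide V c)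
  (μ : ∀ {L : CMField}, SeesawCtx L → Fin 4 → InfinitePlace L → ℤ)
variable {L : CMField} {ι₁ : L →+* ℂ} (V : HermSpace3 L ι₁) (c : SeesawCtx L)

/-- `_ge` TWIN of `hyp34_of_census_R1At_of_hμ₃₄` (guard `6 ≤ [c.K:ℚ]` in place of `= 6`; statement otherwise verbatim, proof = the original's with the one `_ge` callee). **ROW 19 (`hyp34`) AT THE R1 PIN MODULO (J-μ)₃₄ ONLY**: #78 `hyp34_of_census_R1At` AT THE TWISTED CENSUS `σ := sigma34 c.D`
((B1′) orientation), its junction `homg₃₄` supplied by N4 `omgW_ins₃₄_eq_of_weight` from the scalar identity `hμ₃₄` read at `swapPin c.D u_t`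
(torus `jT₃₄`, exponents `(−μ₂, −μ₃)`). -/
theorem hyp34_of_census_R1At_of_hμ₃₄_ge
    (hc : (thetaModelOf hHD hI h₁ h₃ (orientBitι L ι₁) (_root_.HodgeCM.Model.embOf hHD hI h₁ h₃) (coverOf hHD hI h₁ h₃ hA) (wmOfInput (Wcm hGR (EtaChi.η (@SInstance.χVR @hGR @hGR₀ @hGR₁) @χW) (EtaChi.hη (@SInstance.χVR @hGR @hGR₀ @hGR₁) @χW) (EtaChi.hηc (@SInstance.χVR @hGR @hGR₀ @hGR₁) @χW))) (thetaOf _ (thetaClassInputOf _ (fun V c => thetaSpaceInputOf hHD hI h₁ h₃ S V c))) (d12Of μ) (d34Of μ)).GoodCtx ι₁ c)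
    (hK : 6 ≤ Module.finrank ℚ c.K) (hcan : (InfinitePlace.mk ι₁).embedding = ι₁)
    (jD : InfinitePlace (L : Type) → EqVar → Fin 6)
    (hμ₃₄ : ∀ (hW : (∀ j, 0 < (ι₁ ((dW c.D) j)).re) ∨ ∀ j, (ι₁ ((dW c.D) j)).re < 0)
      (t : (placesAt34 V c.D hW jD (fun w => -μ c 2 w) (fun w => -μ c 3 w)).Tg),
      muScalar34 V c.D (hGR V c) (EtaChi.η (@SInstance.χVR @hGR @hGR₀ @hGR₁) @χW V c) hW jD (fun w => -μ c 2 w) (fun w => -μ c 3 w) t *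
          dIotaAt (L : Type) (frameD V) (dW c.D) (dW_real c.D) ι₁ (swapPin c.D (archOf V c.D (datumAtσ V c.D jD (jIOf V c.D hW) (sigma34 c.D)) (fun w => -μ c 2 w) (fun w => -μ c 3 w) t)) =
        (printPlacesW (InfinitePlace (L : Type))
          (kindOf (L : Type) (frameD V) (frameD_real V) (dW c.D) (dW_real c.D) ι₁ (datumAtσ V c.D jD (jIOf V c.D hW) (sigma34 c.D)))
          (lamOf (L : Type) (frameD V) (frameD_real V) (dW c.D) (dW_real c.D) ι₁ (datumAtσ V c.D jD (jIOf V c.D hW) (sigma34 c.D)))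
          (lamOf_ne_zero (L : Type) (frameD V) (frameD_real V) (dW c.D) (dW_real c.D) ι₁ (datumAtσ V c.D jD (jIOf V c.D hW) (sigma34 c.D)))
          (pinnedVacs (kindOf (L : Type) (frameD V) (frameD_real V) (dW c.D) (dW_real c.D) ι₁ (datumAtσ V c.D jD (jIOf V c.D hW) (sigma34 c.D))) (fun w => -μ c 2 w) (fun w => -μ c 3 w)) t)⁻¹) :
    Nonempty (((coreOf _ (_root_.HodgeCM.Model.embOf hHD hI h₁ h₃) (coverOf hHD hI h₁ h₃ hA) (wmOfInput (Wcm hGR (EtaChi.η (@SInstance.χVR @hGR @hGR₀ @hGR₁) @χW) (EtaChi.hη (@SInstance.χVR @hGR @hGR₀ @hGR₁) @χW) (EtaChi.hηc (@SInstance.χVR @hGR @hGR₀ @hGR₁) @χW))) (thetaOf _ (thetaClassInputOf _ (fun V c => thetaSpaceInputOf hHD hI h₁ h₃ S V c)))).toCore (orientBitι L ι₁)).HypSmoothCore34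
      (((coreOf _ (_root_.HodgeCM.Model.embOf hHD hI h₁ h₃) (coverOf hHD hI h₁ h₃ hA) (wmOfInput (Wcm hGR (EtaChi.η (@SInstance.χVR @hGR @hGR₀ @hGR₁) @χW) (EtaChi.hη (@SInstance.χVR @hGR @hGR₀ @hGR₁) @χW) (EtaChi.hηc (@SInstance.χVR @hGR @hGR₀ @hGR₁) @χW))) (thetaOf _ (thetaClassInputOf _ (fun V c => thetaSpaceInputOf hHD hI h₁ h₃ S V c)))).toCore (orientBitι L ι₁)).side12 (d12Of μ)) (((coreOf _ (_root_.HodgeCM.Model.embOf hHD hI h₁ h₃) (coverOf hHD hI h₁ h₃ hA) (wmOfInput (Wcm hGR (EtaChi.η (@SInstance.χVR @hGR @hGR₀ @hGR₁) @χW) (EtaChi.hη (@SInstance.χVR @hGR @hGR₀ @hGR₁) @χW) (EtaChi.hηc (@SInstance.χVR @hGR @hGR₀ @hGR₁) @χW))) (thetaOf _ (thetaClassInputOf _ (fun V c => thetaSpaceInputOf hHD hI h₁ h₃ S V c)))).toCore (orientBitι L ι₁)).side34 (d34Of μ))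
      ((((coreOf _ (_root_.HodgeCM.Model.embOf hHD hI h₁ h₃) (coverOf hHD hI h₁ h₃ hA) (wmOfInput (Wcm hGR (EtaChi.η (@SInstance.χVR @hGR @hGR₀ @hGR₁) @χW) (EtaChi.hη (@SInstance.χVR @hGR @hGR₀ @hGR₁) @χW) (EtaChi.hηc (@SInstance.χVR @hGR @hGR₀ @hGR₁) @χW))) (thetaOf _ (thetaClassInputOf _ (fun V c => thetaSpaceInputOf hHD hI h₁ h₃ S V c)))).toCore (orientBitι L ι₁)).analyticKM (((coreOf _ (_root_.HodgeCM.Model.embOf hHD hI h₁ h₃) (coverOf hHD hI h₁ h₃ hA) (wmOfInput (Wcm hGR (EtaChi.η (@SInstance.χVR @hGR @hGR₀ @hGR₁) @χW) (EtaChi.hη (@SInstance.χVR @hGR @hGR₀ @hGR₁) @χW) (EtaChi.hηc (@SInstance.χVR @hGR @hGR₀ @hGR₁) @χW))) (thetaOf _ (thetaClassInputOf _ (fun V c => thetaSpaceInputOf hHD hI h₁ h₃ S V c)))).toCore (orientBitι L ι₁)).side12 (d12Of μ))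
        (((coreOf _ (_root_.HodgeCM.Model.embOf hHD hI h₁ h₃) (coverOf hHD hI h₁ h₃ hA) (wmOfInput (Wcm hGR (EtaChi.η (@SInstance.χVR @hGR @hGR₀ @hGR₁) @χW) (EtaChi.hη (@SInstance.χVR @hGR @hGR₀ @hGR₁) @χW) (EtaChi.hηc (@SInstance.χVR @hGR @hGR₀ @hGR₁) @χW))) (thetaOf _ (thetaClassInputOf _ (fun V c => thetaSpaceInputOf hHD hI h₁ h₃ S V c)))).toCore (orientBitι L ι₁)).side34 (d34Of μ))).toAnalytic) V c (ℓ := linOfInput (Wcm hGR (EtaChi.η (@SInstance.χVR @hGR @hGR₀ @hGR₁) @χW) (EtaChi.hη (@SInstance.χVR @hGR @hGR₀ @hGR₁) @χW) (EtaChi.hηc (@SInstance.χVR @hGR @hGR₀ @hGR₁) @χW)) V c)) :=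
  hyp34_of_census_R1At_ge hHD hI h₁ h₃ hA hGR hGR₀ hGR₁ χW S μ V c hc hK hcan jD (σ := sigma34 c.D) fun hW f t φ =>
    omgW_ins₃₄_eq_of_weight V c.D (hGR V c) (EtaChi.η (@SInstance.χVR @hGR @hGR₀ @hGR₁) @χW V c) (EtaChi.hη (@SInstance.χVR @hGR @hGR₀ @hGR₁) @χW V c) (EtaChi.hηc (@SInstance.χVR @hGR @hGR₀ @hGR₁) @χW V c)
      ι₁ V.sylvesterFrame (sylvesterFrame_formCongr V) hW jD (fun w => -μ c 2 w) (fun w => -μ c 3 w) (hμ₃₄ hW) f t φ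

end R1

section GOG

variable (hHD : exists_isReal_hodgeModel) (hI : hodgePQ_independent_of_hodgeModel)
  (h₁ : BallQuotientUniformised)  (h₃ : CMAbelianVarietyRealised)
variable (hA : Arapura2012_Cor_15_4_6)
variable
  (hGR : ∀ {L : CMField} {ι₁ : L →+* ℂ} (V : HermSpace3 L ι₁) (c : SeesawCtx L),
    (cmSplittingDatum (L : Type) finProdFinEquiv (frameD V) (frameD_real V) (frameD_ne V) (dW c.D) (dW_real c.D) (dW_ne c.D)).CompatibleSplitting)
  (hGR₀ : ∀ {L : CMField} {ι₁ : L →+* ℂ} (V : HermSpace3 L ι₁) (c : SeesawCtx L),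
    (cmSplittingDatum (L : Type) (e₁) (frameD V) (frameD_real V) (frameD_ne V) (lineVec (L : Type) (dW c.D 0))
      (fun _ => dW_real c.D 0) (fun _ => dW_ne c.D 0)).CompatibleSplitting)
  (hGR₁ : ∀ {L : CMField} {ι₁ : L →+* ℂ} (V : HermSpace3 L ι₁) (c : SeesawCtx L),
    (cmSplittingDatum (L : Type) (e₁) (frameD V) (frameD_real V) (frameD_ne V) (lineVec (L : Type) (dW c.D 1))
      (fun _ => dW_real c.D 1) (fun _ => dW_ne c.D 1)).CompatibleSplitting)
  (hGR₂ : ∀ {L : CMField} {ι₁ : L →+* ℂ} (V : HermSpace3 L ι₁) (c : SeesawCtx L),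
    (cmSplittingDatum (L : Type) (e₁) (frameD V) (frameD_real V) (frameD_ne V) (lineVec (L : Type) (dW' c.D 0))
      (fun _ => dW'_real c.D 0) (fun _ => dW'_ne c.D 0)).CompatibleSplitting)
  (hGR₃ : ∀ {L : CMField} {ι₁ : L →+* ℂ} (V : HermSpace3 L ι₁) (c : SeesawCtx L),
    (cmSplittingDatum (L : Type) (e₁) (frameD V) (frameD_real V) (frameD_ne V) (lineVec (L : Type) (dW' c.D 1))
      (fun _ => dW'_real c.D 1) (fun _ => dW'_ne c.D 1)).CompatibleSplitting)
  (S : ∀ {L : CMField} {ι₁ : L →+* ℂ} (V : HermSpace3 L ι₁) (c : SeesawCtx L), ThetaAdelicSide V c)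
  (μ : ∀ {L : CMField}, SeesawCtx L → Fin 4 → InfinitePlace L → ℤ)
variable {L : CMField} {ι₁ : L →+* ℂ} (V : HermSpace3 L ι₁) (c : SeesawCtx L)

include hGR₂ hGR₃ in
/-- `_ge` TWIN of `hyp34_of_census_R1At_GOG` (guard `6 ≤ [c.K:ℚ]` in place of `= 6`; statement otherwise verbatim, proof = the original's with the one `_ge` callee). **ROW 19 (`hyp34`) AT E's PIN OF RECORD WITH NO NAMED RESIDUAL**: `hyp34_of_census_R1At_of_hμ₃₄` ((B1′) census
`σ := sigma34 c.D`) at the Stage-B character `χW := SInstance.χWR … (μ♯♯)`, exponents `μ♯♯ := muSharp₂₃ μ` (glue-1's #398-lineage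
instantiation of #78), its (J-μ)₃₄ identity at `swapPin c.D u_t` supplied by theta-3's (K14) `ArchSideTerm.hμ₃₄_GOG` (OG guard `⟨hcan, hc'⟩`);
the census datum `jD` and the side family `S` stay free: (V-val) #78 · (J-dense) #70 · (J-T34) N4 · (J-μ)₃₄ (K14). -/
theorem hyp34_of_census_R1At_GOG_ge
    (hc : (thetaModelOf hHD hI h₁ h₃ (orientBitι L ι₁) (_root_.HodgeCM.Model.embOf hHD hI h₁ h₃) (coverOf hHD hI h₁ h₃ hA) (wmOfInput (Wcm hGR (EtaChi.η (@SInstance.χVR @hGR @hGR₀ @hGR₁) (@SInstance.χWR @hGR @hGR₀ @hGR₁ (ArchSideTerm.muSharp₂₃ @μ))) (EtaChi.hη (@SInstance.χVR @hGR @hGR₀ @hGR₁) (@SInstance.χWR @hGR @hGR₀ @hGR₁ (ArchSideTerm.muSharp₂₃ @μ))) (EtaChi.hηc (@SInstance.χVR @hGR @hGR₀ @hGR₁) (@SInstance.χWR @hGR @hGR₀ @hGR₁ (ArchSideTerm.muSharp₂₃ @μ))))) (thetaOf _ (thetaClassInputOf _ (fun V c => thetaSpaceInputOf hHD hI h₁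 h₃ S V c))) (d12Of (ArchSideTerm.muSharp₂₃ @μ)) (d34Of (ArchSideTerm.muSharp₂₃ @μ))).GoodCtx ι₁ c)
    (hK : 6 ≤ Module.finrank ℚ c.K) (hcan : (InfinitePlace.mk ι₁).embedding = ι₁)
    (jD : InfinitePlace (L : Type) → EqVar → Fin 6) :
    Nonempty (((coreOf _ (_root_.HodgeCM.Model.embOf hHD hI h₁ h₃) (coverOf hHD hI h₁ h₃ hA) (wmOfInput (Wcm hGR (EtaChi.η (@SInstance.χVR @hGR @hGR₀ @hGR₁) (@SInstance.χWR @hGR @hGR₀ @hGR₁ (ArchSideTerm.muSharp₂₃ @μ))) (EtaChi.hη (@SInstance.χVR @hGR @hGR₀ @hGR₁) (@SInstance.χWR @hGR @hGR₀ @hGR₁ (ArchSideTerm.muSharp₂₃ @μ))) (EtaChi.hηc (@SInstance.χVR @hGR @hGR₀ @hGR₁) (@SInstance.χWR @hGR @hGR₀ @hGR₁ (ArchSideTerm.muSharp₂₃ @μ))))) (thetaOf _ (thetaClassInputOf _ (fun V c => thetaSpaceInputOf hHD hI h₁ h₃ S V c)))).toCore (orientBitι L ι₁)).HypSmoothCo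re34
      (((coreOf _ (_root_.HodgeCM.Model.embOf hHD hI h₁ h₃) (coverOf hHD hI h₁ h₃ hA) (wmOfInput (Wcm hGR (EtaChi.η (@SInstance.χVR @hGR @hGR₀ @hGR₁) (@SInstance.χWR @hGR @hGR₀ @hGR₁ (ArchSideTerm.muSharp₂₃ @μ))) (EtaChi.hη (@SInstance.χVR @hGR @hGR₀ @hGR₁) (@SInstance.χWR @hGR @hGR₀ @hGR₁ (ArchSideTerm.muSharp₂₃ @μ))) (EtaChi.hηc (@SInstance.χVR @hGR @hGR₀ @hGR₁) (@SInstance.χWR @hGR @hGR₀ @hGR₁ (ArchSideTerm.muSharp₂₃ @μ))))) (thetaOf _ (thetaClassInputOf _ (fun V c => thetaSpaceInputOf hHD hI h₁ h₃ S V c)))).toCore (orientBitι L ι₁)).side12 (d12Of (ArchSideTerm.muSharp₂₃ @μ))) (((coreOf _ (_root_.HodgeCM.Model.embOf hHD hI h₁ h₃) (coverOf hHD hI h₁ h₃ hA) (wmOfInput (Wcm hGR (EtaChi.η (@SInstance.χVR @hGR @hGR₀ @hGR₁) (@SInstance.χWR @hGR @hGR₀ @hGR₁ (ArchSideTerm.muSharp₂₃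 @μ))) (EtaChi.hη (@SInstance.χVR @hGR @hGR₀ @hGR₁) (@SInstance.χWR @hGR @hGR₀ @hGR₁ (ArchSideTerm.muSharp₂₃ @μ))) (EtaChi.hηc (@SInstance.χVR @hGR @hGR₀ @hGR₁) (@SInstance.χWR @hGR @hGR₀ @hGR₁ (ArchSideTerm.muSharp₂₃ @μ))))) (thetaOf _ (thetaClassInputOf _ (fun V c => thetaSpaceInputOf hHD hI h₁ h₃ S V c)))).toCore (orientBitι L ι₁)).side34 (d34Of (ArchSideTerm.muSharp₂₃ @μ)))
      ((((coreOf _ (_root_.HodgeCM.Model.embOf hHD hI h₁ h₃) (coverOf hHD hI h₁ h₃ hA) (wmOfInput (Wcm hGR (EtaChi.η (@SInstance.χVR @hGR @hGR₀ @hGR₁) (@SInstance.χWR @hGR @hGR₀ @hGR₁ (ArchSideTerm.muSharp₂₃ @μ))) (EtaChi.hη (@SInstance.χVR @hGR @hGR₀ @hGR₁) (@SInstance.χWR @hGR @hGR₀ @hGR₁ (ArchSideTerm.muSharp₂₃ @μ))) (EtaChi.hηc (@SInstance.χVR @hGR @hGR₀ @hGR₁) (@SInstance.χWR @hGR @hGR₀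 @hGR₁ (ArchSideTerm.muSharp₂₃ @μ))))) (thetaOf _ (thetaClassInputOf _ (fun V c => thetaSpaceInputOf hHD hI h₁ h₃ S V c)))).toCore (orientBitι L ι₁)).analyticKM (((coreOf _ (_root_.HodgeCM.Model.embOf hHD hI h₁ h₃) (coverOf hHD hI h₁ h₃ hA) (wmOfInput (Wcm hGR (EtaChi.η (@SInstance.χVR @hGR @hGR₀ @hGR₁) (@SInstance.χWR @hGR @hGR₀ @hGR₁ (ArchSideTerm.muSharp₂₃ @μ))) (EtaChi.hη (@SInstance.χVR @hGR @hGR₀ @hGR₁) (@SInstance.χWR @hGR @hGR₀ @hGR₁ (ArchSideTerm.muSharp₂₃ @μ))) (EtaChi.hηc (@SInstance.χVR @hGR @hGR₀ @hGR₁) (@SInstance.χWR @hGR @hGR₀ @hGR₁ (ArchSideTerm.muSharp₂₃ @μ))))) (thetaOf _ (thetaClassInputOf _ (fun V c => thetaSpaceInputOf hHD hI h₁ h₃ S V c)))).toCore (orientBitι L ι₁)).side12 (d12Of (ArchSideTerm.muSharp₂₃ @μ)))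
        (((coreOf _ (_root_.HodgeCM.Model.embOf hHD hI h₁ h₃) (coverOf hHD hI h₁ h₃ hA) (wmOfInput (Wcm hGR (EtaChi.η (@SInstance.χVR @hGR @hGR₀ @hGR₁) (@SInstance.χWR @hGR @hGR₀ @hGR₁ (ArchSideTerm.muSharp₂₃ @μ))) (EtaChi.hη (@SInstance.χVR @hGR @hGR₀ @hGR₁) (@SInstance.χWR @hGR @hGR₀ @hGR₁ (ArchSideTerm.muSharp₂₃ @μ))) (EtaChi.hηc (@SInstance.χVR @hGR @hGR₀ @hGR₁) (@SInstance.χWR @hGR @hGR₀ @hGR₁ (ArchSideTerm.muSharp₂₃ @μ))))) (thetaOf _ (thetaClassInputOf _ (fun V c => thetaSpaceInputOf hHD hI h₁ h₃ S V c)))).toCore (orientBitι L ι₁)).side34 (d34Of (ArchSideTerm.muSharp₂₃ @μ)))).toAnalytic) V c (ℓ := linOfInput (Wcm hGR (EtaChi.η (@SInstance.χVR @hGR @hGR₀ @hGR₁) (@SInstance.χWR @hGR @hGR₀ @hGR₁ (ArchSideTerm.muSharp₂₃ @μ))) (EtaChi.hη (@SInstance.χVR @hGR @hGR₀ @hGR₁)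 (@SInstance.χWR @hGR @hGR₀ @hGR₁ (ArchSideTerm.muSharp₂₃ @μ))) (EtaChi.hηc (@SInstance.χVR @hGR @hGR₀ @hGR₁) (@SInstance.χWR @hGR @hGR₀ @hGR₁ (ArchSideTerm.muSharp₂₃ @μ)))) V c)) :=
  have hc' : SignRecipe.GoodCtx (orientBitι L ι₁) ι₁ c :=
    ((cpinC hHD hI h₁ h₃ hA (Wcm hGR (EtaChi.η (@SInstance.χVR @hGR @hGR₀ @hGR₁) (@SInstance.χWR @hGR @hGR₀ @hGR₁ (ArchSideTerm.muSharp₂₃ @μ))) (EtaChi.hη (@SInstance.χVR @hGR @hGR₀ @hGR₁) (@SInstance.χWR @hGR @hGR₀ @hGR₁ (ArchSideTerm.muSharp₂₃ @μ))) (EtaChi.hηc (@SInstance.χVR @hGR @hGR₀ @hGR₁) (@SInstance.χWR @hGR @hGR₀ @hGR₁ (ArchSideTerm.muSharp₂₃ @μ)))) S).thetaModel_goodCtx_iff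
      (orientBitι L ι₁) (d12Of (ArchSideTerm.muSharp₂₃ @μ)) (d34Of (ArchSideTerm.muSharp₂₃ @μ)) ι₁ c).mp hc
  hyp34_of_census_R1At_of_hμ₃₄_ge hHD hI h₁ h₃ hA hGR hGR₀ hGR₁ (@SInstance.χWR @hGR @hGR₀ @hGR₁ (ArchSideTerm.muSharp₂₃ @μ)) S (ArchSideTerm.muSharp₂₃ @μ) V c hc hK hcan jD
    fun hW t => ArchSideTerm.hμ₃₄_GOG hGR (@SInstance.χVR @hGR @hGR₀ @hGR₁) hGR₀ hGR₁ hGR₂ hGR₃ μ V c ⟨hcan, hc'⟩ hW _ t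

end GOG

end HodgeCM.Model.HypCensus

end
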